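import Mathlib
import Summits.AtomisticToContinuum.HydrodynamicLimit.Theorems.ImplosionDichotomyDenseExcursionSonicRealBoundUnique

/-!
# Barrier (Grönwall-type) lemmas from `−∞` and the centre limits of a regular pair
# (crux `DenseExcursion`, line `sonic-cavity-renewal`, brick for `centreContent_of_tube`)

Helper file (`--supports stmt-AtomisticToContinuum-12586`, line lead a2, stub-worker W3 for `centreContent_of_tube`).

Two ingredients of the inner (centre) standing-wave estimate:

* four integration-free comparison lemmas (`barrier_upper_atBot`, `barrier_lower_atBot`, `barrier_upper_Icc`,
  `barrier_lower_Icc`): a real function with `f′ ≤ 𝔞′f + 𝔟′` (resp. `≥ −𝔞′f − 𝔟′`) and explicit majorant primitives `𝔞, 𝔟`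
  is bounded by `e^{𝔞}(ℓ + 𝔟)` (resp. `e^{−𝔞}(ℓ − e^{K}𝔟)`) in terms of its limit `ℓ` at `−∞` (resp. its initial value);
* `regularPair_centre_limits` (registered helper): for a regular pair, `eˣŵ → 0` and `eˣŝ → σ` as `x → −∞` (the velocity
  direction field is odd along the axis, the sound-speed field is continuous at the origin).

NOT here: the mode system or any estimate of it.
-/

noncomputable section

open Filter Set
open scoped Topology

namespace Summit.AtomisticToContinuum.HydrodynamicLimit.Theorems.SonicCavityRenewal

open Summit.AtomisticToContinuum.HydrodynamicLimit.Theorems.R2OneModeTwoConditions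
open Literature.MathematicalPhysics.KineticTheory (V3)
open Summit.AtomisticToContinuum.HydrodynamicLimit.Theorems.KidderKnobMelnikov (norm_smul_unitVec smul_unitVec_apply_zero)

/-! ## Barriers -/

/-- UPPER BARRIER FROM `−∞`: if `f′ ≤ 𝔞′f + 𝔟′` on `x ≤ x₀` with `𝔞 ≥ 0`, `𝔟′ ≥ 0`, and `f → ℓ`, `𝔞 → 0`, `𝔟 → 0` at `−∞`,
then `f ≤ e^{𝔞}(ℓ + 𝔟)` on `x ≤ x₀` (`fe^{−𝔞} − 𝔟` is antitone and tends to `ℓ`). [folklore] -/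
theorem barrier_upper_atBot {f f' 𝔞 𝔞' 𝔟 𝔟' : ℝ → ℝ} {x₀ ℓ : ℝ}
    (hf : ∀ x ≤ x₀, HasDerivAt f (f' x) x) (h𝔞 : ∀ x ≤ x₀, HasDerivAt 𝔞 (𝔞' x) x)
    (h𝔟 : ∀ x ≤ x₀, HasDerivAt 𝔟 (𝔟' x) x)
    (hineq : ∀ x ≤ x₀, f' x ≤ 𝔞' x * f x + 𝔟' x) (h𝔞0 : ∀ x ≤ x₀, 0 ≤ 𝔞 x) (h𝔟0 : ∀ x ≤ x₀, 0 ≤ 𝔟' x)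
    (hfl : Tendsto f atBot (𝓝 ℓ)) (h𝔞l : Tendsto 𝔞 atBot (𝓝 0)) (h𝔟l : Tendsto 𝔟 atBot (𝓝 0)) :
    ∀ x ≤ x₀, f x ≤ Real.exp (𝔞 x) * (ℓ + 𝔟 x) := by
  set g : ℝ → ℝ := fun x => f x * Real.exp (-𝔞 x) - 𝔟 x with hg
  have hgd : ∀ x ≤ x₀, HasDerivAt g ((f' x - 𝔞' x * f x) * Real.exp (-𝔞 x) - 𝔟' x) x := by
    intro x hx
    have h1 : HasDerivAt (fun y => Real.exp (-𝔞 y)) (Real.exp (-𝔞 x) * (-𝔞' x)) x := (h𝔞 x hx).neg.exp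
    refine (((hf x hx).mul h1).sub (h𝔟 x hx)).congr_deriv ?_
    ring
  have hgneg : ∀ x ≤ x₀, (f' x - 𝔞' x * f x) * Real.exp (-𝔞 x) - 𝔟' x ≤ 0 := by
    intro x hx
    have h1 : (f' x - 𝔞' x * f x) * Real.exp (-𝔞 x) ≤ 𝔟' x * Real.exp (-𝔞 x) :=
      mul_le_mul_of_nonneg_right (by linarith [hineq x hx]) (Real.exp_pos _).le
    have h2 : 𝔟' x * Real.exp (-𝔞 x) ≤ 𝔟' x * 1 :=
      mul_le_mul_of_nonneg_left (Real.exp_le_one_iff.2 (by linarith [h𝔞0 x hx])) (h𝔟0 x hx)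
    linarith
  have hanti : AntitoneOn g (Iic x₀) :=
    antitoneOn_of_hasDerivWithinAt_nonpos (convex_Iic x₀)
      (fun x hx => (hgd x (mem_Iic.mp hx)).continuousAt.continuousWithinAt)
      (fun x hx => (hgd x (mem_Iic.mp (interior_subset hx))).hasDerivWithinAt)
      fun x hx => hgneg x (mem_Iic.mp (interior_subset hx))
  have hgl : Tendsto g atBot (𝓝 ℓ) := by
    have h1 : Tendsto (fun x => Real.exp (-𝔞 x)) atBot (𝓝 1) := by
      have h0 : Tendsto (fun x => -𝔞 x) atBot (𝓝 0) := by simpa using h𝔞l.neg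
      have h2 := (Real.continuous_exp.tendsto 0).comp h0
      rwa [Real.exp_zero] at h2
    have := (hfl.mul h1).sub h𝔟l
    simpa [hg] using this
  intro x hx
  have hgx : g x ≤ ℓ := by
    refine ge_of_tendsto hgl ?_
    filter_upwards [eventually_le_atBot x] with y hy
    exact hanti (show y ∈ Iic x₀ from hy.trans hx) (show x ∈ Iic x₀ from hx) hy
  have hexp : Real.exp (𝔞 x) * Real.exp (-𝔞 x) = 1 := by rw [← Real.exp_add, add_neg_cancel, Real.exp_zero]
  have : f x = Real.exp (𝔞 x) * (g x + 𝔟 x) := by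
    simp only [hg]
    calc f x = f x * (Real.exp (𝔞 x) * Real.exp (-𝔞 x)) := by rw [hexp, mul_one]
      _ = _ := by ring
  rw [this]
  exact mul_le_mul_of_nonneg_left (by linarith) (Real.exp_pos _).le

/-- LOWER BARRIER FROM `−∞`: if `f′ ≥ −𝔞′f − 𝔟′` on `x ≤ x₀` with `𝔞 ≤ K`, `𝔟′ ≥ 0`, and `f → ℓ`, `𝔞 → 0`, `𝔟 → 0` at
`−∞`, then `f ≥ e^{−𝔞}(ℓ − e^{K}𝔟)` on `x ≤ x₀` (`fe^{𝔞} + e^{K}𝔟` is monotone and tends to `ℓ`). [folklore] -/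
theorem barrier_lower_atBot {f f' 𝔞 𝔞' 𝔟 𝔟' : ℝ → ℝ} {x₀ ℓ K : ℝ}
    (hf : ∀ x ≤ x₀, HasDerivAt f (f' x) x) (h𝔞 : ∀ x ≤ x₀, HasDerivAt 𝔞 (𝔞' x) x)
    (h𝔟 : ∀ x ≤ x₀, HasDerivAt 𝔟 (𝔟' x) x)
    (hineq : ∀ x ≤ x₀, -(𝔞' x * f x) - 𝔟' x ≤ f' x) (h𝔞K : ∀ x ≤ x₀, 𝔞 x ≤ K) (h𝔟0 : ∀ x ≤ x₀, 0 ≤ 𝔟' x)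
    (hfl : Tendsto f atBot (𝓝 ℓ)) (h𝔞l : Tendsto 𝔞 atBot (𝓝 0)) (h𝔟l : Tendsto 𝔟 atBot (𝓝 0)) :
    ∀ x ≤ x₀, Real.exp (-𝔞 x) * (ℓ - Real.exp K * 𝔟 x) ≤ f x := by
  set g : ℝ → ℝ := fun x => f x * Real.exp (𝔞 x) + Real.exp K * 𝔟 x with hg
  have hgd : ∀ x ≤ x₀, HasDerivAt g ((f' x + 𝔞' x * f x) * Real.exp (𝔞 x) + Real.exp K * 𝔟' x) x := by
    intro x hx
    have h1 : HasDerivAt (fun y => Real.exp (𝔞 y)) (Real.exp (𝔞 x) * 𝔞' x) x := (h𝔞 x hx).exp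
    refine (((hf x hx).mul h1).add ((h𝔟 x hx).const_mul _)).congr_deriv ?_
    ring
  have hgpos : ∀ x ≤ x₀, 0 ≤ (f' x + 𝔞' x * f x) * Real.exp (𝔞 x) + Real.exp K * 𝔟' x := by
    intro x hx
    have h1 : -(𝔟' x) * Real.exp (𝔞 x) ≤ (f' x + 𝔞' x * f x) * Real.exp (𝔞 x) :=
      mul_le_mul_of_nonneg_right (by linarith [hineq x hx]) (Real.exp_pos _).le
    have h2 : 𝔟' x * Real.exp (𝔞 x) ≤ 𝔟' x * Real.exp K :=
      mul_le_mul_of_nonneg_left (Real.exp_le_exp.2 (h𝔞K x hx)) (h𝔟0 x hx)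
    nlinarith
  have hmono : MonotoneOn g (Iic x₀) :=
    monotoneOn_of_hasDerivWithinAt_nonneg (convex_Iic x₀)
      (fun x hx => (hgd x (mem_Iic.mp hx)).continuousAt.continuousWithinAt)
      (fun x hx => (hgd x (mem_Iic.mp (interior_subset hx))).hasDerivWithinAt)
      fun x hx => hgpos x (mem_Iic.mp (interior_subset hx))
  have hgl : Tendsto g atBot (𝓝 ℓ) := by
    have h1 : Tendsto (fun x => Real.exp (𝔞 x)) atBot (𝓝 1) := by
      have h2 := (Real.continuous_exp.tendsto 0).comp h𝔞l
      rwa [Real.exp_zero] at h2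
    have := (hfl.mul h1).add (h𝔟l.const_mul (Real.exp K))
    simpa [hg] using this
  intro x hx
  have hgx : ℓ ≤ g x := by
    refine le_of_tendsto hgl ?_
    filter_upwards [eventually_le_atBot x] with y hy
    exact hmono (show y ∈ Iic x₀ from hy.trans hx) (show x ∈ Iic x₀ from hx) hy
  have hexp : Real.exp (-𝔞 x) * Real.exp (𝔞 x) = 1 := by rw [← Real.exp_add, neg_add_cancel, Real.exp_zero]
  have : f x = Real.exp (-𝔞 x) * (g x - Real.exp K * 𝔟 x) := by
    simp only [hg]
    calc f x = f x * (Real.exp (-𝔞 x) * Real.exp (𝔞 x)) := by rw [hexp, mul_one]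
      _ = _ := by ring
  rw [this]
  exact mul_le_mul_of_nonneg_left (by linarith) (Real.exp_pos _).le

/-- UPPER BARRIER ON AN INTERVAL: if `f′ ≤ 𝔞′f + 𝔟′` on `[x₁, x₀]` with `𝔞 ≥ 0`, `𝔟′ ≥ 0`, then
`f x ≤ e^{𝔞 x}(f(x₁)e^{−𝔞 x₁} − 𝔟 x₁ + 𝔟 x)` there. [folklore] -/
theorem barrier_upper_Icc {f f' 𝔞 𝔞' 𝔟 𝔟' : ℝ → ℝ} {x₁ x₀ : ℝ}
    (hf : ∀ x ∈ Icc x₁ x₀, HasDerivAt f (f' x) x) (h𝔞 : ∀ x ∈ Icc x₁ x₀, HasDerivAt 𝔞 (𝔞' x) x)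
    (h𝔟 : ∀ x ∈ Icc x₁ x₀, HasDerivAt 𝔟 (𝔟' x) x)
    (hineq : ∀ x ∈ Icc x₁ x₀, f' x ≤ 𝔞' x * f x + 𝔟' x) (h𝔞0 : ∀ x ∈ Icc x₁ x₀, 0 ≤ 𝔞 x)
    (h𝔟0 : ∀ x ∈ Icc x₁ x₀, 0 ≤ 𝔟' x) :
    ∀ x ∈ Icc x₁ x₀, f x ≤ Real.exp (𝔞 x) * (f x₁ * Real.exp (-𝔞 x₁) - 𝔟 x₁ + 𝔟 x) := by
  set g : ℝ → ℝ := fun x => f x * Real.exp (-𝔞 x) - 𝔟 x with hg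
  have hgd : ∀ x ∈ Icc x₁ x₀, HasDerivAt g ((f' x - 𝔞' x * f x) * Real.exp (-𝔞 x) - 𝔟' x) x := by
    intro x hx
    have h1 : HasDerivAt (fun y => Real.exp (-𝔞 y)) (Real.exp (-𝔞 x) * (-𝔞' x)) x := (h𝔞 x hx).neg.exp
    refine (((hf x hx).mul h1).sub (h𝔟 x hx)).congr_deriv ?_
    ring
  have hgneg : ∀ x ∈ Icc x₁ x₀, (f' x - 𝔞' x * f x) * Real.exp (-𝔞 x) - 𝔟' x ≤ 0 := by
    intro x hx
    have h1 : (f' x - 𝔞' x * f x) * Real.exp (-𝔞 x) ≤ 𝔟' x * Real.exp (-𝔞 x) :=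
      mul_le_mul_of_nonneg_right (by linarith [hineq x hx]) (Real.exp_pos _).le
    have h2 : 𝔟' x * Real.exp (-𝔞 x) ≤ 𝔟' x * 1 :=
      mul_le_mul_of_nonneg_left (Real.exp_le_one_iff.2 (by linarith [h𝔞0 x hx])) (h𝔟0 x hx)
    linarith
  have hanti : AntitoneOn g (Icc x₁ x₀) :=
    antitoneOn_of_hasDerivWithinAt_nonpos (convex_Icc x₁ x₀)
      (fun x hx => (hgd x hx).continuousAt.continuousWithinAt)
      (fun x hx => (hgd x (interior_subset hx)).hasDerivWithinAt)
      fun x hx => hgneg x (interior_subset hx)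
  intro x hx
  have hgx : g x ≤ g x₁ := hanti (left_mem_Icc.2 (hx.1.trans hx.2)) hx hx.1
  have hexp : Real.exp (𝔞 x) * Real.exp (-𝔞 x) = 1 := by rw [← Real.exp_add, add_neg_cancel, Real.exp_zero]
  have : f x = Real.exp (𝔞 x) * (g x + 𝔟 x) := by
    simp only [hg]
    calc f x = f x * (Real.exp (𝔞 x) * Real.exp (-𝔞 x)) := by rw [hexp, mul_one]
      _ = _ := by ring
  rw [this]
  refine mul_le_mul_of_nonneg_left ?_ (Real.exp_pos _).le
  simp only [hg] at hgx ⊢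
  linarith

/-- LOWER BARRIER ON AN INTERVAL: if `f′ ≥ −𝔞′f − 𝔟′` on `[x₁, x₀]` with `𝔞 ≤ K`, `𝔟′ ≥ 0`, then
`f x ≥ e^{−𝔞 x}(f(x₁)e^{𝔞 x₁} + e^{K}𝔟 x₁ − e^{K}𝔟 x)` there. [folklore] -/
theorem barrier_lower_Icc {f f' 𝔞 𝔞' 𝔟 𝔟' : ℝ → ℝ} {x₁ x₀ K : ℝ}
    (hf : ∀ x ∈ Icc x₁ x₀, HasDerivAt f (f' x) x) (h𝔞 : ∀ x ∈ Icc x₁ x₀, HasDerivAt 𝔞 (𝔞' x) x)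
    (h𝔟 : ∀ x ∈ Icc x₁ x₀, HasDerivAt 𝔟 (𝔟' x) x)
    (hineq : ∀ x ∈ Icc x₁ x₀, -(𝔞' x * f x) - 𝔟' x ≤ f' x) (h𝔞K : ∀ x ∈ Icc x₁ x₀, 𝔞 x ≤ K)
    (h𝔟0 : ∀ x ∈ Icc x₁ x₀, 0 ≤ 𝔟' x) :
    ∀ x ∈ Icc x₁ x₀, Real.exp (-𝔞 x) * (f x₁ * Real.exp (𝔞 x₁) + Real.exp K * 𝔟 x₁ - Real.exp K * 𝔟 x) ≤ f x := by
  set g : ℝ → ℝ := fun x => f x * Real.exp (𝔞 x) + Real.exp K * 𝔟 x with hg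
  have hgd : ∀ x ∈ Icc x₁ x₀, HasDerivAt g ((f' x + 𝔞' x * f x) * Real.exp (𝔞 x) + Real.exp K * 𝔟' x) x := by
    intro x hx
    have h1 : HasDerivAt (fun y => Real.exp (𝔞 y)) (Real.exp (𝔞 x) * 𝔞' x) x := (h𝔞 x hx).exp
    refine (((hf x hx).mul h1).add ((h𝔟 x hx).const_mul _)).congr_deriv ?_
    ring
  have hgpos : ∀ x ∈ Icc x₁ x₀, 0 ≤ (f' x + 𝔞' x * f x) * Real.exp (𝔞 x) + Real.exp K * 𝔟' x := by
    intro x hx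
    have h1 : -(𝔟' x) * Real.exp (𝔞 x) ≤ (f' x + 𝔞' x * f x) * Real.exp (𝔞 x) :=
      mul_le_mul_of_nonneg_right (by linarith [hineq x hx]) (Real.exp_pos _).le
    have h2 : 𝔟' x * Real.exp (𝔞 x) ≤ 𝔟' x * Real.exp K :=
      mul_le_mul_of_nonneg_left (Real.exp_le_exp.2 (h𝔞K x hx)) (h𝔟0 x hx)
    nlinarith
  have hmono : MonotoneOn g (Icc x₁ x₀) :=
    monotoneOn_of_hasDerivWithinAt_nonneg (convex_Icc x₁ x₀)
      (fun x hx => (hgd x hx).continuousAt.continuousWithinAt)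
      (fun x hx => (hgd x (interior_subset hx)).hasDerivWithinAt)
      fun x hx => hgpos x (interior_subset hx)
  intro x hx
  have hgx : g x₁ ≤ g x := hmono (left_mem_Icc.2 (hx.1.trans hx.2)) hx hx.1
  have hexp : Real.exp (-𝔞 x) * Real.exp (𝔞 x) = 1 := by rw [← Real.exp_add, neg_add_cancel, Real.exp_zero]
  have : f x = Real.exp (-𝔞 x) * (g x - Real.exp K * 𝔟 x) := by
    simp only [hg]
    calc f x = f x * (Real.exp (-𝔞 x) * Real.exp (𝔞 x)) := by rw [hexp, mul_one]
      _ = _ := by ring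
  rw [this]
  refine mul_le_mul_of_nonneg_left ?_ (Real.exp_pos _).le
  simp only [hg] at hgx ⊢
  linarith

/-! ## Centre limits of a regular pair -/

/-- A real function continuous at `0` and odd on `t ≠ 0` vanishes at `0`. [folklore] -/
theorem eq_zero_of_odd_continuousAt {φ : ℝ → ℝ} (hφ : ContinuousAt φ 0) (hodd : ∀ t, 0 < t → φ (-t) = -φ t) :
    φ 0 = 0 := by
  have h1 : Tendsto φ (𝓝[>] 0) (𝓝 (φ 0)) := hφ.tendsto.mono_left nhdsWithin_le_nhds
  have h2 : Tendsto (fun t => φ (-t)) (𝓝[>] 0) (𝓝 (φ 0)) := by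
    have hn : Tendsto (fun t : ℝ => -t) (𝓝[>] 0) (𝓝 0) := by
      have := (continuous_neg.tendsto (0 : ℝ)).mono_left (nhdsWithin_le_nhds (s := Ioi 0))
      simpa using this
    exact hφ.tendsto.comp hn
  have h3 : Tendsto (fun t => -φ t) (𝓝[>] 0) (𝓝 (φ 0)) := by
    refine h2.congr' ?_
    filter_upwards [self_mem_nhdsWithin] with t ht using hodd t ht
  have h4 : Tendsto (fun t => -φ t) (𝓝[>] 0) (𝓝 (-φ 0)) := h1.neg
  have := tendsto_nhds_unique h3 h4
  linarith

/-- **Registered helper `regularPair_centre_limits` for `centreContent_of_tube`: THE CENTRE LIMITS OF A REGULAR PAIR.** If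
`(ŵ, ŝ)` is a regular pair (`IsRegularPair`: the fields `Re/Im ŵ(log‖y‖)·y`, `‖y‖·Re/Im ŝ(log‖y‖)` extend to smooth fields
`F₁, F₂, G₁, G₂` on `ℝ³`), then `eˣŵ(x) → 0` and `eˣŝ(x) → σ := G₁(0) + iG₂(0)` as `x → −∞`: along the axis `t e₀` the first
coordinate of `Fⱼ(t e₀)` is a continuous ODD function of `t`, hence vanishes at `t = 0`, and `Gⱼ(eˣ e₀) = eˣ·(Re/Im) ŝ(x)`.
[folklore] -/
theorem regularPair_centre_limits : ∀ (ŵ ŝ : ℝ → ℂ), IsRegularPair ŵ ŝ → ∃ σ : ℂ, Filter.Tendsto (fun x => (Real.exp x : ℂ) * ŵ x) Filter.atBot (nhds 0) ∧ Filter.Tendsto (fun x => (Real.exp x : ℂ) * ŝ x) Filter.atBot (nhds σ) := by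
  intro ŵ ŝ hreg
  obtain ⟨-, -, F₁, F₂, G₁, G₂, hF₁, hF₂, hG₁, hG₂, hFG⟩ := hreg
  set e₀ : V3 := EuclideanSpace.single 0 1 with he₀
  have hl : Continuous fun t : ℝ => t • e₀ := continuous_id.smul continuous_const
  -- values along the axis
  have hpos : ∀ t : ℝ, 0 < t →
      (F₁ (t • e₀)) 0 = (ŵ (Real.log t)).re * t ∧ (F₂ (t • e₀)) 0 = (ŵ (Real.log t)).im * t ∧
        G₁ (t • e₀) = t * (ŝ (Real.log t)).re ∧ G₂ (t • e₀) = t * (ŝ (Real.log t)).im := by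
    intro t ht
    have hy : t • e₀ ≠ 0 := norm_pos_iff.1 (by rw [norm_smul_unitVec ht.le]; exact ht)
    obtain ⟨h1, h2, h3, h4⟩ := hFG _ hy
    rw [norm_smul_unitVec ht.le] at h1 h2 h3 h4
    refine ⟨?_, ?_, h3.symm, h4.symm⟩
    · rw [← h1, smul_smul, smul_unitVec_apply_zero]
    · rw [← h2, smul_smul, smul_unitVec_apply_zero]
  have hneg : ∀ t : ℝ, 0 < t →
      (F₁ ((-t) • e₀)) 0 = -((ŵ (Real.log t)).re * t) ∧ (F₂ ((-t) • e₀)) 0 = -((ŵ (Real.log t)).im * t) := by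
    intro t ht
    have hn : ‖(-t) • e₀‖ = t := by rw [neg_smul, norm_neg, norm_smul_unitVec ht.le]
    have hy : (-t) • e₀ ≠ 0 := norm_pos_iff.1 (by rw [hn]; exact ht)
    obtain ⟨h1, h2, -, -⟩ := hFG _ hy
    rw [hn] at h1 h2
    refine ⟨?_, ?_⟩
    · rw [← h1, smul_smul, smul_unitVec_apply_zero]; ring
    · rw [← h2, smul_smul, smul_unitVec_apply_zero]; ring
  -- the two odd coordinate functions vanish at 0
  have hφ₁ : (F₁ 0) 0 = 0 := by
    have hc : ContinuousAt (fun t : ℝ => (F₁ (t • e₀)) 0) 0 := by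
      have : Continuous fun t : ℝ => (F₁ (t • e₀)) 0 :=
        (EuclideanSpace.proj (0 : Fin 3)).continuous.comp (hF₁.continuous.comp hl)
      exact this.continuousAt
    have h := eq_zero_of_odd_continuousAt hc (fun t ht => by rw [(hneg t ht).1, (hpos t ht).1])
    simpa using h
  have hφ₂ : (F₂ 0) 0 = 0 := by
    have hc : ContinuousAt (fun t : ℝ => (F₂ (t • e₀)) 0) 0 := by
      have : Continuous fun t : ℝ => (F₂ (t • e₀)) 0 :=
        (EuclideanSpace.proj (0 : Fin 3)).continuous.comp (hF₂.continuous.comp hl)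
      exact this.continuousAt
    have h := eq_zero_of_odd_continuousAt hc (fun t ht => by rw [(hneg t ht).2, (hpos t ht).2.1])
    simpa using h
  -- limits along x → -∞ (t = eˣ → 0)
  have hexp0 : Tendsto (fun x : ℝ => Real.exp x • e₀) atBot (𝓝 0) := by
    simpa using Real.tendsto_exp_atBot.smul_const e₀
  have hre : Tendsto (fun x => (ŵ x).re * Real.exp x) atBot (𝓝 0) := by
    have h := ((EuclideanSpace.proj (0 : Fin 3)).continuous.comp hF₁.continuous).tendsto 0
    have h2 := h.comp hexp0
    simp only [Function.comp_def, EuclideanSpace.coe_proj] at h2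
    rw [hφ₁] at h2
    refine h2.congr fun x => ?_
    rw [(hpos (Real.exp x) (Real.exp_pos x)).1, Real.log_exp]
  have him : Tendsto (fun x => (ŵ x).im * Real.exp x) atBot (𝓝 0) := by
    have h := ((EuclideanSpace.proj (0 : Fin 3)).continuous.comp hF₂.continuous).tendsto 0
    have h2 := h.comp hexp0
    simp only [Function.comp_def, EuclideanSpace.coe_proj] at h2
    rw [hφ₂] at h2
    refine h2.congr fun x => ?_
    rw [(hpos (Real.exp x) (Real.exp_pos x)).2.1, Real.log_exp]
  have hsre : Tendsto (fun x => Real.exp x * (ŝ x).re) atBot (𝓝 (G₁ 0)) := by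
    have h2 := (hG₁.continuous.tendsto 0).comp hexp0
    refine h2.congr fun x => ?_
    simp only [Function.comp_apply]
    rw [(hpos (Real.exp x) (Real.exp_pos x)).2.2.1, Real.log_exp]
  have hsim : Tendsto (fun x => Real.exp x * (ŝ x).im) atBot (𝓝 (G₂ 0)) := by
    have h2 := (hG₂.continuous.tendsto 0).comp hexp0
    refine h2.congr fun x => ?_
    simp only [Function.comp_apply]
    rw [(hpos (Real.exp x) (Real.exp_pos x)).2.2.2, Real.log_exp]
  refine ⟨⟨G₁ 0, G₂ 0⟩, ?_, ?_⟩
  · have h := ((Complex.continuous_ofReal.tendsto 0).comp hre).add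
      (((Complex.continuous_ofReal.tendsto 0).comp him).mul_const Complex.I)
    simp only [Complex.ofReal_zero, zero_mul, add_zero] at h
    refine h.congr fun x => ?_
    apply Complex.ext <;> simp [Function.comp_apply] <;> ring
  · have h := ((Complex.continuous_ofReal.tendsto (G₁ 0)).comp hsre).add
      (((Complex.continuous_ofReal.tendsto (G₂ 0)).comp hsim).mul_const Complex.I)
    have e : ((G₁ 0 : ℝ) : ℂ) + ((G₂ 0 : ℝ) : ℂ) * Complex.I = ⟨G₁ 0, G₂ 0⟩ := by
      apply Complex.ext <;> simp
    rw [e] at h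
    refine h.congr fun x => ?_
    apply Complex.ext <;> simp [Function.comp_apply]

end Summit.AtomisticToContinuum.HydrodynamicLimit.Theorems.SonicCavityRenewal

end
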